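import Summits.Ventures.QEC.Census.LP.LP120w5.Distance
import Summits.Ventures.QEC.Census.LPTyped
import HarnessLib

/-!
# `LP120w5` IS Panteleev–Kalachev's lifted product `LP(A, [b])`, `A = [1 1; 1 x⁶]`, `b = 1 + x² + x¹⁰` over `𝔽₂[x]/(x³⁰ − 1)` — the census row `[[120, 8, 8]]` on the TYPED construction

The census object `LP120w5.cert.code _` (explicit check words, `Census/LP/LP120w5/Cert.lean`; census id `LPb_2x2_l30_b0-2-10_E0-0.0-6`,
cell D.1-lite) is, along the layout bijections of `Census/LPTyped.lean` (`r = 30·i + a`, `q = 30·c + t`), EXACTLY the flat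
check-matrix pair `(𝔅H_X(A,[b]), 𝔅H_Z(A,[b]))` of the typed lifted product `LPTyped.lpCode 30 E [0, 2, 10]`
(`Literature/…/LiftedProduct.lean`: `LiftedProduct.xMatrix` / `zMatrix` over `30 × 30` circulant blocks): `HX_eq`, `HZ_eq`
by `decide +kernel` on the product-free entry formulas `LiftedProduct.xMatrix_eq_of_xEntry` / `zMatrix_eq_of_zEntry`
(60 × 120 and 60 × 120 entries). Hence the row's KERNEL theorem `LP120w5.isCode` transports (type-05 FACT P,
`CSSCode.isCode_iff_of_submatrix`) to **`isCode_lp : (lpCode 30 E [0, 2, 10]).IsCode 120 8 8`** — a `[[120,8,8]]` theorem about the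
TYPED Panteleev–Kalachev construction, not just about a list of words. Tier KERNEL, axioms standard, no `native_decide`.
qec-search-4 g3 (`tools/emit_typed.py LPb_2x2_l30_b0-2-10_E0-0.0-6 LP120w5`).
-/

set_option autoImplicit false

namespace Summit.Ventures.QEC.Census.LP120w5

open Matrix Literature.InformationTheory.QuantumCodes LiftedProduct Summit.Ventures.QEC.Census.LPTyped

/-- Exponent matrix `E` of `A = [1 1; 1 x⁶]` (2 × 2). (definition) -/
def E : Fin 2 → Fin 2 → ℕ := ![![0, 0], ![0, 6]]

/-- **The census object's `H^X` is `𝔅(H_X(A, [b]))` relabelled** (`decide +kernel` over all `60 × 120` entries of the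
product-free entry formula). -/
theorem HX_eq : (LP120w5.cert.code (LP120w5.cert.commOK_of_checkStructure checkStructure_ok)).HX =
    (lpCode 30 E [0, 2, 10]).HX.submatrix ((finCongr (by decide)).trans (rowEquiv 2 30))
      ((finCongr (by decide)).trans (colEquiv 2 2 30)) := by
  change rowMatrix _ _ = (xMatrix _ _).submatrix _ _
  rw [xMatrix_eq_of_xEntry]
  decide +kernel

/-- **The census object's `H^Z` is `𝔅(H_Z(A, [b]))` relabelled** (`decide +kernel`, `60 × 120` entries). -/
theorem HZ_eq : (LP120w5.cert.code (LP120w5.cert.commOK_of_checkStructure checkStructure_ok)).HZ =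
    (lpCode 30 E [0, 2, 10]).HZ.submatrix ((finCongr (by decide)).trans (rowEquiv 2 30))
      ((finCongr (by decide)).trans (colEquiv 2 2 30)) := by
  change rowMatrix _ _ = (zMatrix _ _).submatrix _ _
  rw [zMatrix_eq_of_zEntry]
  decide +kernel

/-- **Panteleev–Kalachev's `LP(A, [b])` with `A = [1 1; 1 x⁶]`, `b = 1 + x² + x¹⁰` over `𝔽₂[x]/(x³⁰ − 1)` is a `[[120, 8, 8]]` code** —
the KERNEL census row `LP120w5.isCode` transported to the typed construction by type-05's FACT P
(`CSSCode.isCode_iff_of_submatrix` with `HX_eq`, `HZ_eq`). [cite: PanteleevKalachev2022LP] -/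
theorem isCode_lp : (lpCode 30 E [0, 2, 10]).IsCode 120 8 8 :=
  (CSSCode.isCode_iff_of_submatrix HX_eq HZ_eq 120 8 8).1 isCode

/-- **The census object is a lifted-product code** in the sense of qec-type-07's predicate `IsLiftedProduct` (PARTITION row 07):
witnesses `ℓ = 30`, `A = monoBlocks 30 E` (2 × 2), `B = polyBlock 30 [0, 2, 10]` (1 × 1), the layout bijections, element-wise
commutation of circulant blocks, and `HX_eq` / `HZ_eq`. (appended, qec-search-4 g3) [cite: PanteleevKalachev2022LP, §III.D (arXiv:2012.04068 chunk p0011 L41-44)] -/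
theorem isLiftedProduct : IsLiftedProduct (LP120w5.cert.code (LP120w5.cert.commOK_of_checkStructure checkStructure_ok)).HX (LP120w5.cert.code (LP120w5.cert.commOK_of_checkStructure checkStructure_ok)).HZ :=
  ⟨30, 2, 2, 1, 1, monoBlocks 30 E, polyBlock 30 [0, 2, 10], (finCongr (by decide)).trans (rowEquiv 2 30),
    (finCongr (by decide)).trans (rowEquiv 2 30), (finCongr (by decide)).trans (colEquiv 2 2 30),
    elementwiseCommute_mono_poly 30 E [0, 2, 10], HX_eq, HZ_eq⟩

end Summit.Ventures.QEC.Census.LP120w5
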